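import Mathlib
import HarnessLib
import Summits.NavierStokesRegularity.NavierStokesRegularity.Theses.RellichScar
import Summits.NavierStokesRegularity.NavierStokesRegularity.Theorems.RellichScarApexLocalisationTracelessHalfspaceLiouville
import Summits.NavierStokesRegularity.NavierStokesRegularity.Theorems.RellichScarApexLocalisationTracelessConeLiouvilleLiSverak
import Summits.NavierStokesRegularity.NavierStokesRegularity.Theorems.RellichScarApexLocalisationFaintOfCalmBoundedTrace
import Literature.Analysis.FluidPDE.ParasiticSlabFlow

/-!
# No tame side at a Type-I singular point: calm + bounded trace, the apex-class trace, and the line certificate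
# (line calm-cone-carleman, crux ApexLocalisation stmt-NavierStokesRegularity-11719, lead a3)

Three corollaries of the landed stubs S_A (`stub_tracelessHalfspaceLiouville`, p130873), S_L
(`stub_tracelessConeLiouvilleOfLiSverak`, p131153) and S_B (`stub_faintOfCalmBoundedTrace`, p131380) of the line
`calm-cone-carleman`, registered as stubs of the crux `RellichScar.ApexLocalisation`:

* `stub_calmBoundedTraceNotSingular` — a continuous suitable weak slab solution with a weak gradient, `𝐈 < ⊤` and
  the Type-I RATE which, on a REFLEX cone `Γ_κ(e) = {κ‖x‖ < ⟪x,e⟫}` with `κ < 0` (opening angle `> 180°`), is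
  apex-CALM (`‖u‖ ≤ K/(‖x‖ + √(−t))`) and has a BOUNDED FINAL TRACE near the vertex (`‖u(t,x)‖ ≤ B` as `t ↑ 0` for
  each `x ∈ Γ_κ(e)`, `‖x‖ < δ₀`) is NOT singular at the origin (S_B with `κ < κ' = 0`, then S_A); and the same
  on every cone with `κ < 1/√3` (opening `> 109.5°`) under Li–Šverák's cone backward uniqueness
  `Literature.Analysis.FluidPDE.coneBackwardUniquenessC12` (S_B with `κ' = (max κ 0 + 1/√3)/2`, then S_L).
* `stub_apexTraceUnboundedReflexCone` — the APEX-class reading (for the sibling cruxes ScarRigidity 11717 /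
  SymmetricScarExists 11718 and the support NoMildScar 11723): a continuous apex profile (`‖u‖ ≤ C/(‖x‖+√(−t))`)
  singular at the origin has an UNBOUNDED final trace in every reflex cone at the origin — for every unit `e`,
  `κ < 0`, `δ₀ > 0` and `B` some `x ∈ Γ_κ(e)` with `‖x‖ < δ₀` has `‖u(t,x)‖ > B` for `t ↑ 0` frequently ("the scar
  of a singular apex profile is unbounded in every solid angle > 2π sr at every scale"; under Li–Šverák in every
  solid angle of opening `> 109.5°`).
* `stub_cruxIffTameSideSelection` — the line CERTIFICATE: the crux `ApexLocalisation` is EQUIVALENT to the line's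
  bet `stub_tameSideSelection` (apex ∨ faint-half-space ∨ calm-bounded-trace-reflex-cone selection), because the two
  tame alternatives are empty classes by S_A and `stub_calmBoundedTraceNotSingular`.  Hence the composition stub of
  the line is the crux itself modulo landed theorems (terminal shape; cf. p94902, p102219, p114611, p119999,
  p128744 for the round-1/round-2 lines).

References: Escauriaza–Seregin–Šverák 2003 (Thm. 5.1); Li–Šverák, CPDE 37 (2012), Thm. 1.1; Seregin–Šverák 2009 §2
(Serrin regularity); Albritton–Barker 2019 §3.
-/

noncomputable section

set_option linter.dupNamespace false

namespace Summit.NavierStokesRegularity.NavierStokesRegularity.Theorems.RellichScarApexLocalisation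

open MeasureTheory Set Function Metric Filter Topology TopologicalSpace
open scoped ENNReal NNReal InnerProductSpace RealInnerProductSpace
open Literature.Analysis Literature.Analysis.FluidPDE

local notation "E³" => EuclideanSpace ℝ (Fin 3)

/-- The open backward slab `(-∞, 0) × ℝ³` (time first). -/
local notation "𝕊" => Literature.Analysis.FluidPDE.slab (EuclideanSpace ℝ (Fin 3)) (Set.Iio (0 : ℝ)) isOpen_Iio

/-! ### Calm with bounded final trace on a wide cone is not singular -/

/-- The intermediate slope `κ' = (max κ 0 + 1/√3)/2` lies strictly between `κ` and `1/√3` and is `≥ 0`,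
whenever `κ < 1/√3`. [folklore] -/
theorem midSlope_facts {κ : ℝ} (hκ : κ < 1 / Real.sqrt 3) :
    κ < (max κ 0 + 1 / Real.sqrt 3) / 2 ∧ 0 ≤ (max κ 0 + 1 / Real.sqrt 3) / 2 ∧
      (max κ 0 + 1 / Real.sqrt 3) / 2 < 1 / Real.sqrt 3 := by
  have h3 : 0 < 1 / Real.sqrt 3 := by positivity
  have hmax : max κ 0 < 1 / Real.sqrt 3 := max_lt hκ h3
  refine ⟨?_, ?_, ?_⟩
  · have := le_max_left κ 0
    linarith
  · have := le_max_right κ 0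
    linarith
  · linarith

/-- **Calm with bounded final trace on a wide cone is not singular (stub_calmBoundedTraceNotSingular).**
(i) Unconditionally on REFLEX cones (`κ < 0`): a continuous suitable weak Navier–Stokes solution on the backward
slab with a weak gradient, `𝐈 < ⊤` and the Type-I rate `‖u(t,x)‖ ≤ C/√(−t)` which is apex-calm
(`‖u(t,x)‖ ≤ K/(‖x‖ + √(−t))`) on `Γ_κ(e) = {κ‖x‖ < ⟪x,e⟫}` and whose final trace is bounded near the vertex there
(`‖u(t,x)‖ ≤ B` eventually as `t ↑ 0`, for each `x ∈ Γ_κ(e)` with `‖x‖ < δ₀`) is NOT singular at the origin —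
S_B (`stub_faintOfCalmBoundedTrace`, slopes `κ < 0`) makes it scar-faint on the half-space `{⟪x,e⟫ > 0}` and S_A
(`stub_tracelessHalfspaceLiouville`) concludes.  (ii) Under Li–Šverák's cone backward uniqueness
`coneBackwardUniquenessC12` the same holds on every cone with `κ < 1/√3` (opening `> 109.5°`): S_B with the slope
`κ' = (max κ 0 + 1/√3)/2`, then S_L (`stub_tracelessConeLiouvilleOfLiSverak`).
[cite: EscauriazaSereginSverak2003, Thm. 5.1] [cite: LiSverak2012, Thm. 1.1] -/
theorem stub_calmBoundedTraceNotSingular :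
    (∀ (C κ K B δ₀ : ℝ) (e : E³), κ < 0 → ‖e‖ = 1 → 0 < δ₀ →
      ∀ (u : ℝ → E³ → E³) (p : ℝ → E³ → ℝ) (G : ℝ → E³ → E³ →L[ℝ] E³),
      IsSuitableWeakSolutionOn 𝕊 1 0 u p → HasWeakSpatialGradientOn 𝕊 u G →
      typeIBound (Iio (0 : ℝ) ×ˢ univ) u p G < ⊤ → HasTypeITimeDecay C u →
      ContinuousOn (uncurry u) (Iio (0 : ℝ) ×ˢ univ) →
      (∀ t : ℝ, t < 0 → ∀ x : E³, κ * ‖x‖ < ⟪x, e⟫ → ‖u t x‖ ≤ K / (‖x‖ + Real.sqrt (-t))) →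
      (∀ x : E³, κ * ‖x‖ < ⟪x, e⟫ → ‖x‖ < δ₀ → ∀ᶠ t in 𝓝[<] (0 : ℝ), ‖u t x‖ ≤ B) →
      ¬ IsBackwardSingularPoint u 0) ∧
    (coneBackwardUniquenessC12 → ∀ (C κ K B δ₀ : ℝ) (e : E³), κ < 1 / Real.sqrt 3 → ‖e‖ = 1 → 0 < δ₀ →
      ∀ (u : ℝ → E³ → E³) (p : ℝ → E³ → ℝ) (G : ℝ → E³ → E³ →L[ℝ] E³),
      IsSuitableWeakSolutionOn 𝕊 1 0 u p → HasWeakSpatialGradientOn 𝕊 u G →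
      typeIBound (Iio (0 : ℝ) ×ˢ univ) u p G < ⊤ → HasTypeITimeDecay C u →
      ContinuousOn (uncurry u) (Iio (0 : ℝ) ×ˢ univ) →
      (∀ t : ℝ, t < 0 → ∀ x : E³, κ * ‖x‖ < ⟪x, e⟫ → ‖u t x‖ ≤ K / (‖x‖ + Real.sqrt (-t))) →
      (∀ x : E³, κ * ‖x‖ < ⟪x, e⟫ → ‖x‖ < δ₀ → ∀ᶠ t in 𝓝[<] (0 : ℝ), ‖u t x‖ ≤ B) →
      ¬ IsBackwardSingularPoint u 0) := by
  refine ⟨?_, ?_⟩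
  · intro C κ K B δ₀ e hκ he hδ₀ u p G hsw hwg hI hrate hcont hcalm htrace
    have hfaint := stub_faintOfCalmBoundedTrace κ 0 hκ C K B δ₀ e he hδ₀ u p G hsw hwg hI hrate hcont hcalm htrace
    refine stub_tracelessHalfspaceLiouville C e he u p G hsw hwg hI hrate fun ε hε => ?_
    obtain ⟨δ, hδ, η, hη, h⟩ := hfaint ε hε
    exact ⟨δ, hδ, η, hη, fun x hx hxδ t ht1 ht2 => h x (by rwa [zero_mul]) hxδ t ht1 ht2⟩
  · intro hBU C κ K B δ₀ e hκ he hδ₀ u p G hsw hwg hI hrate hcont hcalm htrace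
    obtain ⟨hκκ', hκ'0, hκ'1⟩ := midSlope_facts hκ
    have hfaint := stub_faintOfCalmBoundedTrace κ _ hκκ' C K B δ₀ e he hδ₀ u p G hsw hwg hI hrate hcont hcalm htrace
    exact stub_tracelessConeLiouvilleOfLiSverak hBU _ hκ'0 hκ'1 e he C u p G hsw hwg hI hrate hfaint

/-! ### The apex class: unbounded final trace in every wide cone -/

/-- **The scar of a singular apex profile is unbounded in every wide cone (stub_apexTraceUnboundedReflexCone).**
(i) Let `u` be a continuous suitable weak slab solution with a weak gradient, `𝐈 < ⊤` and the space–time Type-I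
(apex) bound `‖u(t,x)‖ ≤ C/(‖x‖ + √(−t))`, singular at the origin.  Then for every unit `e`, every `κ < 0`, every
`δ₀ > 0` and every `B` there is `x ∈ Γ_κ(e)` with `‖x‖ < δ₀` at which `‖u(t,x)‖ > B` for times `t ↑ 0`
frequently: the apex bound IS calmness on every cone (`K = C`) and gives the rate (`0 ≤ C`), so a bounded final
trace on a reflex cone would contradict `stub_calmBoundedTraceNotSingular` (i).  (ii) Under
`coneBackwardUniquenessC12` the same for every `κ < 1/√3`.  The directional `L^∞` form of NoMildScar for the route's
sibling cruxes: the one-slice invariant (the scar) of a singular apex profile is unbounded in every solid angle of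
opening `> 180°` (`> 109.5°` given Li–Šverák) at every scale. [cite: EscauriazaSereginSverak2003, Thm. 5.1]
[cite: LiSverak2012, Thm. 1.1] -/
theorem stub_apexTraceUnboundedReflexCone :
    (∀ (C κ δ₀ B : ℝ) (e : E³), κ < 0 → ‖e‖ = 1 → 0 < δ₀ →
      ∀ (u : ℝ → E³ → E³) (p : ℝ → E³ → ℝ) (G : ℝ → E³ → E³ →L[ℝ] E³),
      IsSuitableWeakSolutionOn 𝕊 1 0 u p → HasWeakSpatialGradientOn 𝕊 u G →
      typeIBound (Iio (0 : ℝ) ×ˢ univ) u p G < ⊤ → HasTypeIDecay C u → IsBackwardSingularPoint u 0 →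
      ContinuousOn (uncurry u) (Iio (0 : ℝ) ×ˢ univ) →
      ∃ x : E³, κ * ‖x‖ < ⟪x, e⟫ ∧ ‖x‖ < δ₀ ∧ ∃ᶠ t in 𝓝[<] (0 : ℝ), B < ‖u t x‖) ∧
    (coneBackwardUniquenessC12 → ∀ (C κ δ₀ B : ℝ) (e : E³), κ < 1 / Real.sqrt 3 → ‖e‖ = 1 → 0 < δ₀ →
      ∀ (u : ℝ → E³ → E³) (p : ℝ → E³ → ℝ) (G : ℝ → E³ → E³ →L[ℝ] E³),
      IsSuitableWeakSolutionOn 𝕊 1 0 u p → HasWeakSpatialGradientOn 𝕊 u G →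
      typeIBound (Iio (0 : ℝ) ×ˢ univ) u p G < ⊤ → HasTypeIDecay C u → IsBackwardSingularPoint u 0 →
      ContinuousOn (uncurry u) (Iio (0 : ℝ) ×ˢ univ) →
      ∃ x : E³, κ * ‖x‖ < ⟪x, e⟫ ∧ ‖x‖ < δ₀ ∧ ∃ᶠ t in 𝓝[<] (0 : ℝ), B < ‖u t x‖) := by
  refine ⟨?_, ?_⟩
  · intro C κ δ₀ B e hκ he hδ₀ u p G hsw hwg hI hapex hsing hcont
    by_contra hcon
    push Not at hcon
    have hC : 0 ≤ C := nonneg_of_hasTypeIDecay hapex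
    have htrace : ∀ x : E³, κ * ‖x‖ < ⟪x, e⟫ → ‖x‖ < δ₀ → ∀ᶠ t in 𝓝[<] (0 : ℝ), ‖u t x‖ ≤ B := by
      intro x hx hxδ
      have h := hcon x hx hxδ
      simpa [Filter.not_frequently, not_lt] using h
    exact stub_calmBoundedTraceNotSingular.1 C κ C B δ₀ e hκ he hδ₀ u p G hsw hwg hI (hapex.hasTypeITimeDecay hC)
      hcont (fun t ht x _ => hapex t ht x) htrace hsing
  · intro hBU C κ δ₀ B e hκ he hδ₀ u p G hsw hwg hI hapex hsing hcont
    by_contra hcon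
    push Not at hcon
    have hC : 0 ≤ C := nonneg_of_hasTypeIDecay hapex
    have htrace : ∀ x : E³, κ * ‖x‖ < ⟪x, e⟫ → ‖x‖ < δ₀ → ∀ᶠ t in 𝓝[<] (0 : ℝ), ‖u t x‖ ≤ B := by
      intro x hx hxδ
      have h := hcon x hx hxδ
      simpa [Filter.not_frequently, not_lt] using h
    exact stub_calmBoundedTraceNotSingular.2 hBU C κ C B δ₀ e hκ he hδ₀ u p G hsw hwg hI
      (hapex.hasTypeITimeDecay hC) hcont (fun t ht x _ => hapex t ht x) htrace hsing

/-! ### The line certificate: crux ⇔ bet -/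

/-- **Certificate (stub_cruxIffTameSideSelection): `ApexLocalisation` ⇔ the line's bet `stub_tameSideSelection`.**
`⇒`: the crux' conclusion is the first disjunct of the bet.  `⇐`: the second disjunct (an origin-singular rate
profile scar-faint on a half-space) is impossible by S_A, the third (calm with bounded trace on a reflex cone,
continuous) by `stub_calmBoundedTraceNotSingular` (i); the first is the crux' conclusion.  So the composition
stub of the line `calm-cone-carleman` is crux-EQUIVALENT modulo landed theorems — the line cannot close the crux
by itself (terminal shape shared with the round-1 lines). [folklore] -/
theorem stub_cruxIffTameSideSelection :
    Summit.NavierStokesRegularity.NavierStokesRegularity.Theses.RellichScar.ApexLocalisation ↔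
    (∀ C : ℝ, (∃ (u : ℝ → E³ → E³) (p : ℝ → E³ → ℝ) (G : ℝ → E³ → E³ →L[ℝ] E³),
        IsSuitableWeakSolutionOn 𝕊 1 0 u p ∧ HasWeakSpatialGradientOn 𝕊 u G ∧
        typeIBound (Set.Iio (0 : ℝ) ×ˢ Set.univ) u p G < ⊤ ∧ HasTypeITimeDecay C u ∧ IsBackwardSingularPoint u 0) →
      (∃ (C' : ℝ) (u : ℝ → E³ → E³) (p : ℝ → E³ → ℝ) (G : ℝ → E³ → E³ →L[ℝ] E³),
        IsSuitableWeakSolutionOn 𝕊 1 0 u p ∧ HasWeakSpatialGradientOn 𝕊 u G ∧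
        typeIBound (Set.Iio (0 : ℝ) ×ˢ Set.univ) u p G < ⊤ ∧ HasTypeIDecay C' u ∧ IsBackwardSingularPoint u 0) ∨
      (∃ (C₁ : ℝ) (e : E³) (u : ℝ → E³ → E³) (p : ℝ → E³ → ℝ) (G : ℝ → E³ → E³ →L[ℝ] E³),
        ‖e‖ = 1 ∧ IsSuitableWeakSolutionOn 𝕊 1 0 u p ∧ HasWeakSpatialGradientOn 𝕊 u G ∧
        typeIBound (Set.Iio (0 : ℝ) ×ˢ Set.univ) u p G < ⊤ ∧ HasTypeITimeDecay C₁ u ∧ IsBackwardSingularPoint u 0 ∧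
        (∀ ε : ℝ, 0 < ε → ∃ δ : ℝ, 0 < δ ∧ ∃ η : ℝ, 0 < η ∧ ∀ x : E³, 0 < ⟪x, e⟫ → ‖x‖ < δ →
          ∀ t : ℝ, -η * ‖x‖ ^ 2 < t → t < 0 → ‖x‖ * ‖u t x‖ ≤ ε)) ∨
      (∃ (C₁ κ K B δ₀ : ℝ) (e : E³) (u : ℝ → E³ → E³) (p : ℝ → E³ → ℝ) (G : ℝ → E³ → E³ →L[ℝ] E³),
        κ < 0 ∧ ‖e‖ = 1 ∧ 0 < δ₀ ∧ IsSuitableWeakSolutionOn 𝕊 1 0 u p ∧ HasWeakSpatialGradientOn 𝕊 u G ∧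
        typeIBound (Set.Iio (0 : ℝ) ×ˢ Set.univ) u p G < ⊤ ∧ HasTypeITimeDecay C₁ u ∧ IsBackwardSingularPoint u 0 ∧
        ContinuousOn (Function.uncurry u) (Set.Iio (0 : ℝ) ×ˢ Set.univ) ∧
        (∀ t : ℝ, t < 0 → ∀ x : E³, κ * ‖x‖ < ⟪x, e⟫ → ‖u t x‖ ≤ K / (‖x‖ + Real.sqrt (-t))) ∧
        (∀ x : E³, κ * ‖x‖ < ⟪x, e⟫ → ‖x‖ < δ₀ → ∀ᶠ t in nhdsWithin (0 : ℝ) (Set.Iio 0), ‖u t x‖ ≤ B))) := by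
  constructor
  · intro hcrux C h
    exact Or.inl (hcrux C h)
  · intro hbet C h
    rcases hbet C h with hapex | hfaint | hcalm
    · exact hapex
    · obtain ⟨C₁, e, u, p, G, he, hsw, hwg, hI, hrate, hsing, hf⟩ := hfaint
      exact absurd hsing (stub_tracelessHalfspaceLiouville C₁ e he u p G hsw hwg hI hrate hf)
    · obtain ⟨C₁, κ, K, B, δ₀, e, u, p, G, hκ, he, hδ₀, hsw, hwg, hI, hrate, hsing, hcont, hc, htr⟩ := hcalm
      exact absurd hsing (stub_calmBoundedTraceNotSingular.1 C₁ κ K B δ₀ e hκ he hδ₀ u p G hsw hwg hI hrate hcont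
        hc htr)

end Summit.NavierStokesRegularity.NavierStokesRegularity.Theorems.RellichScarApexLocalisation

end
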